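import Literature.Analysis.ODE.HeunEulerTransform
import HarnessLib

/-!
# Euler's transformation in `τ`-form: the exponent-lowering recursion
# `∂_z F_{κ−1} = (1−κ) F_κ + ∂_t [t F_{κ−1}/(z−1)]`

Topic `Literature/Analysis/ODE` (namespace `Literature.Analysis.ODE.GeneralHeun`; continues
`HeunEulerTransform.lean`). With `F_κ(z,t) = (z−1)^{1−κ}(1−t)^{−κ} v(1+(z−1)t)` (`eulerF κ v z t`),
the one-sided Euler transform `∫₀¹ F_κ dt = ∫₁^z (z−w)^{−κ} v(w) dw` converges at `t = 1` only for
`Re κ < 1`; for larger `Re κ` the transform of [Takemura2017] Prop. 1.2 (a Pochhammer-contour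
integral) is realised on the real line by `z`-DERIVATIVES of lower-exponent transforms, through the
pointwise identity proved here (`hasDerivAt_eulerF_lower`):
`∂_z F_{κ−1}(z,t) = (1−κ)·F_κ(z,t) + ∂_t[ t·F_{κ−1}(z,t)/(z−1) ]`,
stated as: `t ↦ t·F_{κ−1}(z,t)/(z−1)` has `t`-derivative `eulerFz (κ−1) v v₁ z t − (1−κ)·eulerF κ v z t`
(`eulerFz` being the closed form of `∂_z F` from `HeunEulerTransform`). Iterating,
`∂_z^k F_{θ−k} = (1−θ)(2−θ)⋯(k−θ)·F_θ + ∂_t(…)`, which is how the regularised transform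
`∂_z^k ∫₀¹ F_{θ−k} dt` inherits the Heun intertwining of `euler_tau_identity` (exact computer-algebra
companion for the boundary orders, pub-kds kit j167437). Pure calculus; no named facts.

## References
* K. Takemura, J. Math. Soc. Japan 69 (2017) 849–891, Prop. 1.2. Key `Takemura2017`.
-/

noncomputable section

open Set Filter
open scoped Topology

namespace Literature.Analysis.ODE

namespace GeneralHeun

/-- `d/dt k_{κ−1}(1−t) = (κ−1)·k_κ(1−t)` for `t < 1`. [cite: Takemura2017, Proposition 1.2 (kernel)] -/
theorem hasDerivAt_eulerKernel_pred_one_sub (κ : ℂ) {t : ℝ} (ht : t < 1) :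
    HasDerivAt (fun τ : ℝ => eulerKernel (κ - 1) (1 - τ)) ((κ - 1) * eulerKernel κ (1 - t)) t := by
  have h := (hasDerivAt_eulerKernel_pred κ (sub_pos.mpr ht)).comp_const_sub 1 t
  refine h.congr_deriv ?_
  ring

/-- **The exponent-lowering recursion.** For `z > 1`, `t < 1` and `v` differentiable at
`w = 1+(z−1)t` (derivative `v₁ w`):
`∂_t[ t·F_{κ−1}(z,t)/(z−1) ] = ∂_zF_{κ−1}(z,t) − (1−κ)·F_κ(z,t)`,
with `∂_zF_{κ−1}` in the closed form `eulerFz (κ−1)`. [cite: Takemura2017, Proposition 1.2] -/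
theorem hasDerivAt_eulerF_lower {κ : ℂ} {v v₁ : ℝ → ℂ} {z t : ℝ} (hz : 1 < z) (ht : t < 1)
    (hv : HasDerivAt v (v₁ (eulerPt z t)) (eulerPt z t)) :
    HasDerivAt (fun τ : ℝ => (τ : ℂ) * eulerF (κ - 1) v z τ / ((z - 1 : ℝ) : ℂ))
      (eulerFz (κ - 1) v v₁ z t - (1 - κ) * eulerF κ v z t) t := by
  have hz1 : 0 < z - 1 := sub_pos.mpr hz
  have ht1 : 0 < 1 - t := sub_pos.mpr ht
  have hz1' : ((z - 1 : ℝ) : ℂ) ≠ 0 := by exact_mod_cast hz1.ne'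
  -- factors: τ, k_{κ-2}(z-1) (constant), k_{κ-1}(1-τ), v(w(τ))
  have hc : HasDerivAt (fun τ : ℝ => (τ : ℂ)) 1 t := by
    simpa using (hasDerivAt_id t).ofReal_comp
  have hK : HasDerivAt (fun τ : ℝ => eulerKernel (κ - 1 - 1) (z - 1) * eulerKernel (κ - 1) (1 - τ))
      (eulerKernel (κ - 1 - 1) (z - 1) * ((κ - 1) * eulerKernel κ (1 - t))) t :=
    (hasDerivAt_eulerKernel_pred_one_sub κ ht).const_mul _
  have hV : HasDerivAt (fun τ : ℝ => v (eulerPt z τ)) ((z - 1) • v₁ (eulerPt z t)) t :=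
    hv.scomp t (hasDerivAt_eulerPt_t z t)
  have h := ((hc.mul hK).mul hV).div_const ((z - 1 : ℝ) : ℂ)
  have e1 : (fun τ : ℝ => (τ : ℂ) * eulerF (κ - 1) v z τ / ((z - 1 : ℝ) : ℂ)) =
      fun τ : ℝ => (τ : ℂ) * (eulerKernel (κ - 1 - 1) (z - 1) * eulerKernel (κ - 1) (1 - τ)) *
        v (eulerPt z τ) / ((z - 1 : ℝ) : ℂ) := by
    funext τ; unfold eulerF; ring
  rw [e1]
  refine h.congr_deriv ?_
  -- kernel index bookkeeping: k_{κ-2}(z-1) = (z-1) k_{κ-1}(z-1), k_{κ-1}(z-1) = (z-1) k_κ(z-1),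
  -- k_{κ-1}(1-t) = (1-t) k_κ(1-t)
  have hs1 : eulerKernel (κ - 1 - 1) (z - 1) = ((z - 1 : ℝ) : ℂ) * eulerKernel (κ - 1) (z - 1) := by
    rw [← mul_eulerKernel_succ (κ - 1 - 1) hz1, sub_add_cancel]
  have hs2 : eulerKernel (κ - 1) (z - 1) = ((z - 1 : ℝ) : ℂ) * eulerKernel κ (z - 1) := by
    rw [← mul_eulerKernel_succ (κ - 1) hz1, sub_add_cancel]
  have hs3 : eulerKernel (κ - 1) (1 - t) = ((1 - t : ℝ) : ℂ) * eulerKernel κ (1 - t) := by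
    rw [← mul_eulerKernel_succ (κ - 1) ht1, sub_add_cancel]
  simp only [Pi.mul_apply, Complex.real_smul]
  unfold eulerFz eulerF
  rw [hs1, hs2, hs3]
  push_cast
  field_simp
  ring

/-- The same recursion at the level of the values, for use under the integral sign:
`∂_zF_{κ−1} = (1−κ)F_κ + (the t-derivative above)`. [cite: Takemura2017, Proposition 1.2] -/
theorem eulerFz_pred_eq {κ : ℂ} {v v₁ : ℝ → ℂ} {z t : ℝ} (hz : 1 < z) (ht : t < 1)
    (hv : HasDerivAt v (v₁ (eulerPt z t)) (eulerPt z t)) :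
    eulerFz (κ - 1) v v₁ z t =
      (1 - κ) * eulerF κ v z t +
        deriv (fun τ : ℝ => (τ : ℂ) * eulerF (κ - 1) v z τ / ((z - 1 : ℝ) : ℂ)) t := by
  rw [(hasDerivAt_eulerF_lower (κ := κ) hz ht hv).deriv]
  ring

end GeneralHeun

end Literature.Analysis.ODE
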